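import Literature.IUT.HodgeArakelov.ThetaEvaluationModelEvPointed
import Literature.IUT.HodgeArakelov.ThetaEvaluationModelEvRetractionTop

/-!
# [IUTchII] Cor 1.12 (ii) at the model — the topological side conditions of the retractions replaced by
# "`D_{μ_-}` is compact and `ε(D_{μ_-})` has finite index" (proof companion)

Proof-only companion (abc-iut cell, D-0067 wave 4, seat abc-iut-w4-d043 gen 2; L6-lead ruling §F v1.18c (1); SUBDAG
`plan/L6/SUBDAG-IUTchII-Cor-112.md` row Cor-112.ii.r13; node **IUTchII:Cor1.12(ii)**) to `ThetaEvaluationModelEvPointed.lean`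
(`EtaleLevels.cor112_ii_model`, p420795) and `ThetaEvaluationModelEvRetractionTop.lean` (`hlift_of_isCompact`,
`hemb_of_isCompact`). No definitions. S. Mochizuki, *Inter-universal Teichmüller theory II*, Cor. 1.12 (ii) p. 57, Rmk. 1.4.1
(ii) p. 28; *Semi-graphs of anabelioids* §6 p. 71 [cite: MochizukiSemiAnbd2006, §6 p.71] ("`D_x` always surjects onto an open
subgroup of `G_K`"; compactness of `D_x`). Claim key `Mochizuki2012` (DISPUTED); nothing here takes a side on [IUTchIII]
Cor. 3.12.

PROVED: **`EtaleLevels.cor112_ii_model_of_isCompact`** — `cor112_ii_model` with `hlift`/`hemb` replaced by `hDc : IsCompact D_{μ_-}`,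
`[(D_{μ_-}.map ε).FiniteIndex]`, `[T2Space G_{ℚ_p}]`. Residual inputs otherwise unchanged (Rmk. 1.4.1 (ii) data of
`pointedInversionOfPair`, `hDq`, `hα`/`hβ`, `hfix`, `hμ` = GAP G-w4d043-1, the Prop. 2.2 (ii) translates). Typed ≠ discharged.
-/

noncomputable section

namespace Literature.IUT.HodgeArakelov

open Literature.AnabelianGeometry.EtaleTheta Literature.AnabelianGeometry.SemiGraphs CohomologySystemOfContH1
open scoped Literature.AnabelianGeometry.EtaleTheta

namespace EtaleLevels

variable {p : ℕ} [Fact p.Prime] {D : Literature.AnabelianGeometry.EtaleTheta.ThetaSetting p}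
  {E : D.EtaleThetaData} {l : ℕ} (C : E.DoubleUnderline l)

variable (hC : D.Compat) (hS : D.Sec2Hyps)
  (hl : l.Prime) (hp2 : p ≠ 2) (hpl : p ≠ l) (hζ : ∃ ζ : D.K, IsPrimitiveRoot ζ (4 * l))
  (mods : ∀ M : ℕ+, D.CyclotomeMod l M)
  (f : contCocycles D.toTheta D.DeltaTheta C.GtpYdduu) (hf : f ∈ C.rootCocycles hC)
  (hmods : ∀ (M M' : ℕ+) (h : (M : ℕ) ∣ (M' : ℕ)) (x : D.lDeltaTheta l),
    MuN.red p M M' h ((mods M').red x) = (mods M).red x)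
  (h15 : Literature.AnabelianGeometry.EtaleTheta.ThetaSetting.Prop15iii E hC) (L : C.CuspLabels)
  (hZ : ∀ M : ℕ+, Nonempty (ModelCyclotomes.lDeltaQuot (C.rigidData (mods M) hC hS h15 L) ≃*
    Literature.IUT.HodgeTheaters.ZHat))
  (hcharY : EtaleThetaDataOfSetting.PiYddCharacteristic C)
  (hlim : Function.Bijective (rigidLimHom C hC hS hl hp2 hpl hζ mods f hf hmods h15 L hZ))
  (Env : EnvOfGroup (setting C hC hS hl hp2 hpl hζ mods f hf)
    (modelSystem C hC hS hl hp2 hpl hζ mods f hf hmods h15 L hZ).PiX)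
  -- the model pointed inversion (abc-iut-w5-d072's `pointedInversionOfPair`): its named print inputs
  (α : (EtaleThetaDataOfSetting.Pi C) ≃ₜ* (EtaleThetaDataOfSetting.Pi C))
  (hover : ∀ x : EtaleThetaDataOfSetting.Pi C, Env.recon.projG (Env.isoX (α x)) = Env.recon.projG (Env.isoX x))
  (δ : EtaleThetaDataOfSetting.Pi C) (hδ : Env.recon.projG (Env.isoX δ) = 1)
  (hαα : ∀ x : EtaleThetaDataOfSetting.Pi C, α (α x) = δ * x * δ⁻¹)
  (γ : EtaleThetaDataOfSetting.Pi C) (hγ : C.toLZ γ = Multiplicative.ofAdd 1)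
  (hαγ : C.toLZ (α γ) = Multiplicative.ofAdd (-1))
  (huniq : ∀ κ : (EtaleThetaDataOfSetting.Pi C) ≃ₜ* (EtaleThetaDataOfSetting.Pi C),
    (∀ x, Env.recon.projG (Env.isoX (κ x)) = Env.recon.projG (Env.isoX x)) →
    (∃ δ' : EtaleThetaDataOfSetting.Pi C, Env.recon.projG (Env.isoX δ') = 1 ∧ ∀ x, κ (κ x) = δ' * x * δ'⁻¹) →
    (¬ ∃ δ' : EtaleThetaDataOfSetting.Pi C, Env.recon.projG (Env.isoX δ') = 1 ∧ ∀ x, κ x = δ' * x * δ'⁻¹) →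
      ∃ δ' : EtaleThetaDataOfSetting.Pi C, Env.recon.projG (Env.isoX δ') = 1 ∧ ∀ x, κ x = δ' * α x * δ'⁻¹)
  (Dmu : Subgroup (EtaleThetaDataOfSetting.Pi C)) (hDmu : Dmu ≤ EtaleThetaDataOfSetting.PiYdd C)
  (hfixD : ∃ δ' : ↥(EtaleThetaDataOfSetting.PiYdd C), Env.recon.projG (Env.isoX (δ' : EtaleThetaDataOfSetting.Pi C)) = 1 ∧
    ∀ (d : EtaleThetaDataOfSetting.Pi C) (hd : d ∈ Dmu), ((EtaleThetaDataOfSetting.iotaYddOfAut C hcharY α ⟨d, hDmu hd⟩ :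
      EtaleThetaDataOfSetting.PiYdd C) : EtaleThetaDataOfSetting.Pi C) ∈
        Dmu.map (MulAut.conj ((δ' : EtaleThetaDataOfSetting.PiYdd C) : EtaleThetaDataOfSetting.Pi C)).toMonoidHom)
  (etaStd : (EtaleThetaDataOfSetting.coh C).H1 ⊤) (hmem : etaStd ∈ EtaleThetaDataOfSetting.orbitOne C hC)
  (hstd : (2 * (setting C hC hS hl hp2 hpl hζ mods f hf).l) • EtaleThetaDataOfSetting.resDmuOf C Dmu hDmu etaStd = 0)
  -- the coefficient half of the pair and its printed properties
  (β : D.GtpTheta ≃ₜ* D.GtpTheta)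
  (hφ : ∀ g, β (EtaleThetaDataOfSetting.phi C g) = EtaleThetaDataOfSetting.phi C (α g))
  (hAβ : ∀ a : D.GtpTheta, a ∈ D.lDeltaTheta l ↔ β a ∈ D.lDeltaTheta l)
  (hH : ∀ x, x ∈ EtaleThetaDataOfSetting.PiYdd C ↔ α x ∈ EtaleThetaDataOfSetting.PiYdd C)
  -- decomposition-group facts, constants
  (hDq : ∀ d ∈ Dmu, EtaleThetaDataOfSetting.aug C d = 1 → d = 1)
  (hDc : IsCompact (Dmu : Set (EtaleThetaDataOfSetting.Pi C)))
  (cU : CyclotomeCoefficients (EtaleThetaDataOfSetting.phi C) (D.lDeltaTheta l) (PadicAlgCl p)ˣ)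
  (Uu : Subgroup (PadicAlgCl p)ˣ)

/-- **[IUTchII] Cor. 1.12 (ii) at the model, for the MODEL POINTED INVERSION, with the decomposition group COMPACT** (the binders `hlift`/`hemb` of `cor112_ii_model` DISCHARGED by `hlift_of_isCompact`/`hemb_of_isCompact` from: `D_{μ_-}` compact — [SemiAnbd] §6, the cell's `TemperedCurve.isCompact_decomp_of_isTempered` — `ε(D_{μ_-})` of finite index in `G_{ℚ_p}` — "surjects onto an open subgroup of `G_K`" — and `G_{ℚ_p}` Hausdorff, an instance binder). Original statement: Over `Π := Π^tp_{X̲̲}` with REAL continuous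
cohomology of `(l·Δ_Θ)`, abc-iut-w4-d030's `θ_env`-data, abc-iut-w5-d072's RELATIVE pointed inversion `pointedInversionOfPair`
(its `ι = α`, `D_{μ_-} = Dmu`, `η_std = etaStd`, `resDmu` the genuine restriction), the theta-evaluation datum
`EtaleLevels.thetaEvaluation` (inflation section of the canonical retractions of `ε`, constants `ℚ̄_pˣ ⊇ U` through `ε`, `iotaLim :=
pairRhoLim (α, β)`): the typed `Cor112_ii` HOLDS, given exactly the NAMED print inputs listed in the section variables and binders
(Rmk. 1.4.1 (ii) data; `D ∩ Δ = 1` & the topological facts on `D_{μ_-}`; `α` over `G_k`, `β` trivial on `(l·Δ_Θ)`; the cyclotome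
fixed-point fact `hfix`; Kummer theory of MLF `hμ`; the Prop. 2.2 (ii) translate inputs `τ`/`hτ`/`hdesc`/`hrev`/`hfree` on `H¹`).
Discharged in the kernel: `hD₁`/`hD₂` (inflation section), `hι` (the pair fixes Kummer classes of constants), `hθ₀` (translates +
`PointedInversion.standard`), `hres` (genuine `resDmuOf`), `hN`/`hq`/`hψA`/`hαA` (structure of `ε`).
[claim: Mochizuki2012, status: disputed] (IUTchII §1 Cor 1.12 (ii), kurims pp.56-58) -/
theorem cor112_ii_model_of_isCompact [T2Space (GQp p)] [(Dmu.map (EtaleThetaDataOfSetting.aug C)).FiniteIndex]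
    (hα : ∀ x, EtaleThetaDataOfSetting.aug C (α x) = EtaleThetaDataOfSetting.aug C x)
    (hβ : ∀ a : D.GtpTheta, a ∈ D.lDeltaTheta l → β a = a)
    (hfix : ∀ K' : Subgroup (EtaleThetaDataOfSetting.Pi C), K'.FiniteIndex →
      ∀ a : D.lDeltaTheta l, (∀ n : EtaleThetaDataOfSetting.Pi C, n ∈ EtaleThetaDataOfSetting.PiYdd C ⊓ K' →
        MulAut.conjNormal (EtaleThetaDataOfSetting.phi C n) a = a) → a = 1)
    (hμ : ∀ y : h1Lim (EtaleThetaDataOfSetting.phi C) (D.lDeltaTheta l) Dmu ⊥, IsOfFinAddOrder y →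
      y ∈ (thetaEvaluation C hC hS hl hp2 hpl hζ mods f hf hmods h15 L hZ hcharY hlim Env
        (EtaleThetaDataOfSetting.pointedInversionOfPair C hC hS hcharY (setting C hC hS hl hp2 hpl hζ mods f hf)
          (ContinuousMulEquiv.refl _) rfl Env α hover δ hδ hαα γ hγ hαγ huniq Dmu hDmu hfixD etaStd hmem hstd)
        (LevelRetraction.ofAugmentation (EtaleThetaDataOfSetting.phi C) (D.lDeltaTheta l)
          (EtaleThetaDataOfSetting.aug C) Dmu hDq (EtaleThetaDataOfSetting.PiYdd C)
          (EtaleThetaDataOfSetting.continuous_aug C) (aug_ker_acts_trivially C)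
          (hlift_of_isCompact (EtaleThetaDataOfSetting.aug C) Dmu (EtaleThetaDataOfSetting.continuous_aug C) hDc)
          (hemb_of_isCompact (EtaleThetaDataOfSetting.aug C) Dmu (EtaleThetaDataOfSetting.continuous_aug C) hDc hDq))
        cU (EtaleThetaDataOfSetting.isOpen_stabilizer_units C) (EtaleThetaDataOfSetting.finiteIndex_stabilizer_units C)
        Uu (EtaleThetaDataOfSetting.pairRhoLim C α β hφ hAβ hH)).MxTM)
    (τ : ℤ → (EtaleThetaDataOfSetting.coh C).H1 ⊤) (hτ : τ 0 = etaStd)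
    (hdesc : ∀ o ∈ EtaleThetaDataOfSetting.orbitOne C hC,
      ∃ (n : ℤ) (c' : (EtaleThetaDataOfSetting.coh C).H1 ⊤), 2 • c' = 0 ∧ o = τ n + c')
    (hrev : ∀ n : ℤ, IsOfFinAddOrder (EtaleThetaDataOfSetting.pairRho C α β hφ hAβ hH (τ n) - τ (-n)))
    (hfree : ∀ m n : ℤ, IsOfFinAddOrder (τ m - τ n) → m = n) :
    Literature.IUT.HodgeArakelov.Cor112_ii
      (thetaEvaluation C hC hS hl hp2 hpl hζ mods f hf hmods h15 L hZ hcharY hlim Env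
        (EtaleThetaDataOfSetting.pointedInversionOfPair C hC hS hcharY (setting C hC hS hl hp2 hpl hζ mods f hf)
          (ContinuousMulEquiv.refl _) rfl Env α hover δ hδ hαα γ hγ hαγ huniq Dmu hDmu hfixD etaStd hmem hstd)
        (LevelRetraction.ofAugmentation (EtaleThetaDataOfSetting.phi C) (D.lDeltaTheta l)
          (EtaleThetaDataOfSetting.aug C) Dmu hDq (EtaleThetaDataOfSetting.PiYdd C)
          (EtaleThetaDataOfSetting.continuous_aug C) (aug_ker_acts_trivially C)
          (hlift_of_isCompact (EtaleThetaDataOfSetting.aug C) Dmu (EtaleThetaDataOfSetting.continuous_aug C) hDc)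
          (hemb_of_isCompact (EtaleThetaDataOfSetting.aug C) Dmu (EtaleThetaDataOfSetting.continuous_aug C) hDc hDq))
        cU (EtaleThetaDataOfSetting.isOpen_stabilizer_units C) (EtaleThetaDataOfSetting.finiteIndex_stabilizer_units C)
        Uu (EtaleThetaDataOfSetting.pairRhoLim C α β hφ hAβ hH)) :=
  cor112_ii_model C hC hS hl hp2 hpl hζ mods f hf hmods h15 L hZ hcharY hlim Env α hover δ hδ hαα γ hγ hαγ huniq Dmu
    hDmu hfixD etaStd hmem hstd β hφ hAβ hH hDq _ _ cU Uu hα hβ hfix hμ τ hτ hdesc hrev hfree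

end EtaleLevels

end Literature.IUT.HodgeArakelov
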